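import Summits.Ventures.CertifiedArithmetic.Expansions.InsphereExact
import Summits.Ventures.CertifiedArithmetic.Expansions.FilteredExact
import Summits.Ventures.CertifiedArithmetic.Expansions.InsphereFilter
import Summits.Ventures.CertifiedArithmetic.Expansions.InsphereFilterLemmas
import Mathlib.Tactic.Linarith
import Mathlib.Tactic.Positivity
import Mathlib.Tactic.Ring
import Mathlib.Tactic.NormNum

/-!
# A floating-point filter for INSPHERE: correctness, and the complete predicate

NEW WORK of this development (ENGINES group, unit `eng-quad-4`; HONEST FRAMING: shared numerical
engines serving client cells; rigour lives in the verifiers; every published number belongs to a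
client cell's ledger, not to the engines group).  Not a published result, hence under
`Summits/Ventures/` with no citation tag of its own.

`insphereStageA_correct`: for `p ≥ 6`, ANY round-to-nearest `fl` into `F(p, emin)` (any
tie-breaking), `K = isperrboundA p = (16 + 224ε)ε`, and fifteen coordinates floats of `F(p, e₀)`
with `emin ≤ e₀` and `emin + 2p ≤ 5e₀` (every operation of the filter then lives on one of the
grids `2^e₀ ℤ, …, 2^5e₀ ℤ, 2^(5e₀ − 2p) ℤ` above the underflow threshold, so it is exact or rounds
a normal number; for binary64: coordinates that are multiples of `2^−193`), a value `det`
RETURNED by `insphereStageA` has the sign of the exact `insphereDet`, strictly both ways — in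
particular it is nonzero.  The proof is the bookkeeping of grids plus the error analysis of
`InsphereFilterLemmas.lean` (`cofactor → 3 × 3 minor → lift → lifted term → det`, the permanent
from below, `isperrboundA_margin`, `sign_of_err_of_test`).

`insphereFiltered` then composes the filter with the exact stage of `InsphereExact.lean` (when
the filter declines, the sign is read off the largest component of the exact expansion — the
"from scratch" structure Shewchuk himself reports for INSPHERE's last stage, §4.5 p. 352), and
`insphereFiltered_correct` / `insphereFilteredRNE_correct` state that the returned value ALWAYS
has the sign of `insphereDet` (`> 0`, `< 0`, `= 0`), under the hypotheses of both stages.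

HONEST SCOPE.  Statements about functions on `ℚ` parameterised by a rounding; the hypotheses
exclude underflow and overflow is not modelled (unbounded exponents above `emin`).  Nothing is
claimed about the C code of `predicates.c`, whose text we do not hold; the constant
`(16 + 224ε)ε` is proved sufficient for OUR transcription `insphereStageA`.

Reference for the method: J. R. Shewchuk, Discrete Comput. Geom. 18 (1997) 305–363, §4.3
[Shewchuk1997].
-/

namespace Summit.Ventures.CertifiedArithmetic.Expansions

open Literature.ComputerArithmetic.JeannerodRump2018
open Literature.ComputerArithmetic.BoldoJeannerodMelquiondMuller2023 hiding twoSum twoSum_fst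
open Literature.ComputerArithmetic.Shewchuk1997

variable {p : ℕ} {emin : ℤ} {fl : ℚ → ℚ}

-- one hundred and eleven rounding steps on terms of growing size: the default budget is too small
set_option maxHeartbeats 800000 in
/-- **THE INSPHERE FILTER IS CORRECT.**  `p ≥ 6`, `fl` any round-to-nearest into `F(p, emin)`,
`K = isperrboundA p`, coordinates floats of `F(p, e₀)`, `emin ≤ e₀`, `emin + 2p ≤ 5e₀`: a returned
`det` satisfies `det > 0 ↔ insphereDet > 0` and `det < 0 ↔ insphereDet < 0`. -/
theorem insphereStageA_correct (hp : 6 ≤ p) (hfl : IsRoundNearest p emin fl) {e₀ : ℤ}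
    (hk₀ : emin ≤ e₀) (h5 : emin + 2 * p ≤ e₀ + e₀ + e₀ + e₀ + e₀)
    {a₁ a₂ a₃ b₁ b₂ b₃ c₁ c₂ c₃ d₁ d₂ d₃ e₁ e₂ e₃ : ℚ}
    (ha₁ : IsFloat p e₀ a₁) (ha₂ : IsFloat p e₀ a₂) (ha₃ : IsFloat p e₀ a₃)
    (hb₁ : IsFloat p e₀ b₁) (hb₂ : IsFloat p e₀ b₂) (hb₃ : IsFloat p e₀ b₃)
    (hc₁ : IsFloat p e₀ c₁) (hc₂ : IsFloat p e₀ c₂) (hc₃ : IsFloat p e₀ c₃)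
    (hd₁ : IsFloat p e₀ d₁) (hd₂ : IsFloat p e₀ d₂) (hd₃ : IsFloat p e₀ d₃)
    (he₁ : IsFloat p e₀ e₁) (he₂ : IsFloat p e₀ e₂) (he₃ : IsFloat p e₀ e₃) {A : ℚ}
    (hA : insphereStageA fl (isperrboundA p) a₁ a₂ a₃ b₁ b₂ b₃ c₁ c₂ c₃ d₁ d₂ d₃ e₁ e₂ e₃
      = some A) :
    (0 < A ↔ 0 < insphereDet a₁ a₂ a₃ b₁ b₂ b₃ c₁ c₂ c₃ d₁ d₂ d₃ e₁ e₂ e₃) ∧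
      (A < 0 ↔ insphereDet a₁ a₂ a₃ b₁ b₂ b₃ c₁ c₂ c₃ d₁ d₂ d₃ e₁ e₂ e₃ < 0) := by
  have hp1 : 1 ≤ p := le_trans (by norm_num) hp
  have hk₂ : emin ≤ e₀ + e₀ := by omega
  have hk₃ : emin ≤ e₀ + e₀ + e₀ := by omega
  have hk₃' : emin ≤ e₀ + (e₀ + e₀) := by omega
  have hk₅ : emin ≤ e₀ + e₀ + (e₀ + (e₀ + e₀)) := by omega
  have hk₅' : emin ≤ e₀ + e₀ + e₀ + (e₀ + e₀) := by omega
  have hkK : emin ≤ -(2 * (p : ℤ)) + (e₀ + e₀ + e₀ + (e₀ + e₀)) := by omega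
  have hu0 : 0 < unitRoundoff p := by unfold unitRoundoff; positivity
  have hu64 : unitRoundoff p ≤ 1 / 64 := unitRoundoff_le_of_six_le hp
  have hu1 : unitRoundoff p < 1 := by linarith
  have hb2 : (0 : ℚ) ≤ (1 + unitRoundoff p) ^ 2 := by positivity
  have hv : (0 : ℚ) ≤ 5 * unitRoundoff p + 10 * unitRoundoff p ^ 2 + 10 * unitRoundoff p ^ 3
      + 5 * unitRoundoff p ^ 4 + unitRoundoff p ^ 5 := by positivity
  -- a rounding step: its error (relative to the computed / to the true value) and its grid
  have FG : ∀ {k : ℤ}, emin ≤ k → ∀ {t : ℚ}, OnGrid k t →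
      |t - fl t| ≤ unitRoundoff p * |fl t| ∧ OnGrid k (fl t) :=
    fun hk _ ht => ⟨abs_sub_fl_le_eps_mul_abs_fl hp1 hfl hk ht, ht.fl_of hp1 hfl hk⟩
  have TG : ∀ {k : ℤ}, emin ≤ k → ∀ {t : ℚ}, OnGrid k t →
      |t - fl t| ≤ unitRoundoff p * |t| ∧ OnGrid k (fl t) :=
    fun hk _ ht => ⟨abs_sub_fl_le_eps_mul_abs hp1 hfl hk ht, ht.fl_of hp1 hfl hk⟩
  -- the twelve differences (`2^e₀ ℤ`)
  obtain ⟨fa₁, ga₁⟩ := FG hk₀ ((OnGrid.of_isFloat ha₁).sub (OnGrid.of_isFloat he₁))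
  obtain ⟨fa₂, ga₂⟩ := FG hk₀ ((OnGrid.of_isFloat ha₂).sub (OnGrid.of_isFloat he₂))
  obtain ⟨fa₃, ga₃⟩ := FG hk₀ ((OnGrid.of_isFloat ha₃).sub (OnGrid.of_isFloat he₃))
  obtain ⟨fb₁, gb₁⟩ := FG hk₀ ((OnGrid.of_isFloat hb₁).sub (OnGrid.of_isFloat he₁))
  obtain ⟨fb₂, gb₂⟩ := FG hk₀ ((OnGrid.of_isFloat hb₂).sub (OnGrid.of_isFloat he₂))
  obtain ⟨fb₃, gb₃⟩ := FG hk₀ ((OnGrid.of_isFloat hb₃).sub (OnGrid.of_isFloat he₃))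
  obtain ⟨fc₁, gc₁⟩ := FG hk₀ ((OnGrid.of_isFloat hc₁).sub (OnGrid.of_isFloat he₁))
  obtain ⟨fc₂, gc₂⟩ := FG hk₀ ((OnGrid.of_isFloat hc₂).sub (OnGrid.of_isFloat he₂))
  obtain ⟨fc₃, gc₃⟩ := FG hk₀ ((OnGrid.of_isFloat hc₃).sub (OnGrid.of_isFloat he₃))
  obtain ⟨fd₁, gd₁⟩ := FG hk₀ ((OnGrid.of_isFloat hd₁).sub (OnGrid.of_isFloat he₁))
  obtain ⟨fd₂, gd₂⟩ := FG hk₀ ((OnGrid.of_isFloat hd₂).sub (OnGrid.of_isFloat he₂))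
  obtain ⟨fd₃, gd₃⟩ := FG hk₀ ((OnGrid.of_isFloat hd₃).sub (OnGrid.of_isFloat he₃))
  -- the twelve products, six `2 × 2` minors and their absolute row sums (`2^2e₀ ℤ`)
  obtain ⟨fPab, gPab⟩ := FG hk₂ (ga₁.mul gb₂)
  obtain ⟨fPab', gPab'⟩ := FG hk₂ (gb₁.mul ga₂)
  obtain ⟨fMab, gMab⟩ := TG hk₂ (gPab.sub gPab')
  obtain ⟨fAab, gAab⟩ := TG hk₂ (gPab.abs.add gPab'.abs)
  obtain ⟨fPbc, gPbc⟩ := FG hk₂ (gb₁.mul gc₂)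
  obtain ⟨fPbc', gPbc'⟩ := FG hk₂ (gc₁.mul gb₂)
  obtain ⟨fMbc, gMbc⟩ := TG hk₂ (gPbc.sub gPbc')
  obtain ⟨fAbc, gAbc⟩ := TG hk₂ (gPbc.abs.add gPbc'.abs)
  obtain ⟨fPcd, gPcd⟩ := FG hk₂ (gc₁.mul gd₂)
  obtain ⟨fPcd', gPcd'⟩ := FG hk₂ (gd₁.mul gc₂)
  obtain ⟨fMcd, gMcd⟩ := TG hk₂ (gPcd.sub gPcd')
  obtain ⟨fAcd, gAcd⟩ := TG hk₂ (gPcd.abs.add gPcd'.abs)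
  obtain ⟨fPda, gPda⟩ := FG hk₂ (gd₁.mul ga₂)
  obtain ⟨fPda', gPda'⟩ := FG hk₂ (ga₁.mul gd₂)
  obtain ⟨fMda, gMda⟩ := TG hk₂ (gPda.sub gPda')
  obtain ⟨fAda, gAda⟩ := TG hk₂ (gPda.abs.add gPda'.abs)
  obtain ⟨fPac, gPac⟩ := FG hk₂ (ga₁.mul gc₂)
  obtain ⟨fPac', gPac'⟩ := FG hk₂ (gc₁.mul ga₂)
  obtain ⟨fMac, gMac⟩ := TG hk₂ (gPac.sub gPac')
  obtain ⟨fAac, gAac⟩ := TG hk₂ (gPac.abs.add gPac'.abs)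
  obtain ⟨fPbd, gPbd⟩ := FG hk₂ (gb₁.mul gd₂)
  obtain ⟨fPbd', gPbd'⟩ := FG hk₂ (gd₁.mul gb₂)
  obtain ⟨fMbd, gMbd⟩ := TG hk₂ (gPbd.sub gPbd')
  obtain ⟨fAbd, gAbd⟩ := TG hk₂ (gPbd.abs.add gPbd'.abs)
  -- cofactor terms, the four `3 × 3` minors and their permanent blocks (`2^3e₀ ℤ`)
  obtain ⟨fQabc₁, gQabc₁⟩ := TG hk₃' (ga₃.mul gMbc)
  obtain ⟨fBabc₁, gBabc₁⟩ := TG hk₃ (gAbc.mul ga₃.abs)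
  obtain ⟨fQabc₂, gQabc₂⟩ := TG hk₃' (gb₃.mul gMac)
  obtain ⟨fBabc₂, gBabc₂⟩ := TG hk₃ (gAac.mul gb₃.abs)
  obtain ⟨fQabc₃, gQabc₃⟩ := TG hk₃' (gc₃.mul gMab)
  obtain ⟨fBabc₃, gBabc₃⟩ := TG hk₃ (gAab.mul gc₃.abs)
  obtain ⟨fRabc, gRabc⟩ := TG hk₃' (gQabc₁.sub gQabc₂)
  obtain ⟨fSabc, gSabc⟩ := TG hk₃' (gRabc.add gQabc₃)
  obtain ⟨fVabc, gVabc⟩ := TG hk₃ (gBabc₁.add gBabc₂)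
  obtain ⟨fWabc, gWabc⟩ := TG hk₃ (gVabc.add gBabc₃)
  obtain ⟨fQbcd₁, gQbcd₁⟩ := TG hk₃' (gb₃.mul gMcd)
  obtain ⟨fBbcd₁, gBbcd₁⟩ := TG hk₃ (gAcd.mul gb₃.abs)
  obtain ⟨fQbcd₂, gQbcd₂⟩ := TG hk₃' (gc₃.mul gMbd)
  obtain ⟨fBbcd₂, gBbcd₂⟩ := TG hk₃ (gAbd.mul gc₃.abs)
  obtain ⟨fQbcd₃, gQbcd₃⟩ := TG hk₃' (gd₃.mul gMbc)
  obtain ⟨fBbcd₃, gBbcd₃⟩ := TG hk₃ (gAbc.mul gd₃.abs)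
  obtain ⟨fRbcd, gRbcd⟩ := TG hk₃' (gQbcd₁.sub gQbcd₂)
  obtain ⟨fSbcd, gSbcd⟩ := TG hk₃' (gRbcd.add gQbcd₃)
  obtain ⟨fVbcd, gVbcd⟩ := TG hk₃ (gBbcd₁.add gBbcd₂)
  obtain ⟨fWbcd, gWbcd⟩ := TG hk₃ (gVbcd.add gBbcd₃)
  obtain ⟨fQcda₁, gQcda₁⟩ := TG hk₃' (gc₃.mul gMda)
  obtain ⟨fBcda₁, gBcda₁⟩ := TG hk₃ (gAda.mul gc₃.abs)
  obtain ⟨fQcda₂, gQcda₂⟩ := TG hk₃' (gd₃.mul gMac)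
  obtain ⟨fBcda₂, gBcda₂⟩ := TG hk₃ (gAac.mul gd₃.abs)
  obtain ⟨fQcda₃, gQcda₃⟩ := TG hk₃' (ga₃.mul gMcd)
  obtain ⟨fBcda₃, gBcda₃⟩ := TG hk₃ (gAcd.mul ga₃.abs)
  obtain ⟨fRcda, gRcda⟩ := TG hk₃' (gQcda₁.add gQcda₂)
  obtain ⟨fScda, gScda⟩ := TG hk₃' (gRcda.add gQcda₃)
  obtain ⟨fVcda, gVcda⟩ := TG hk₃ (gBcda₁.add gBcda₂)
  obtain ⟨fWcda, gWcda⟩ := TG hk₃ (gVcda.add gBcda₃)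
  obtain ⟨fQdab₁, gQdab₁⟩ := TG hk₃' (gd₃.mul gMab)
  obtain ⟨fBdab₁, gBdab₁⟩ := TG hk₃ (gAab.mul gd₃.abs)
  obtain ⟨fQdab₂, gQdab₂⟩ := TG hk₃' (ga₃.mul gMbd)
  obtain ⟨fBdab₂, gBdab₂⟩ := TG hk₃ (gAbd.mul ga₃.abs)
  obtain ⟨fQdab₃, gQdab₃⟩ := TG hk₃' (gb₃.mul gMda)
  obtain ⟨fBdab₃, gBdab₃⟩ := TG hk₃ (gAda.mul gb₃.abs)
  obtain ⟨fRdab, gRdab⟩ := TG hk₃' (gQdab₁.add gQdab₂)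
  obtain ⟨fSdab, gSdab⟩ := TG hk₃' (gRdab.add gQdab₃)
  obtain ⟨fVdab, gVdab⟩ := TG hk₃ (gBdab₁.add gBdab₂)
  obtain ⟨fWdab, gWdab⟩ := TG hk₃ (gVdab.add gBdab₃)
  -- the four lifts (`2^2e₀ ℤ`), lifted terms and the determinant (`2^5e₀ ℤ`)
  obtain ⟨fKa₁, gKa₁⟩ := FG hk₂ (ga₁.mul ga₁)
  obtain ⟨fKa₂, gKa₂⟩ := FG hk₂ (ga₂.mul ga₂)
  obtain ⟨fKa₃, gKa₃⟩ := FG hk₂ (ga₃.mul ga₃)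
  obtain ⟨fLa', gLa'⟩ := FG hk₂ (gKa₁.add gKa₂)
  obtain ⟨fLa, gLa⟩ := FG hk₂ (gLa'.add gKa₃)
  obtain ⟨fKb₁, gKb₁⟩ := FG hk₂ (gb₁.mul gb₁)
  obtain ⟨fKb₂, gKb₂⟩ := FG hk₂ (gb₂.mul gb₂)
  obtain ⟨fKb₃, gKb₃⟩ := FG hk₂ (gb₃.mul gb₃)
  obtain ⟨fLb', gLb'⟩ := FG hk₂ (gKb₁.add gKb₂)
  obtain ⟨fLb, gLb⟩ := FG hk₂ (gLb'.add gKb₃)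
  obtain ⟨fKc₁, gKc₁⟩ := FG hk₂ (gc₁.mul gc₁)
  obtain ⟨fKc₂, gKc₂⟩ := FG hk₂ (gc₂.mul gc₂)
  obtain ⟨fKc₃, gKc₃⟩ := FG hk₂ (gc₃.mul gc₃)
  obtain ⟨fLc', gLc'⟩ := FG hk₂ (gKc₁.add gKc₂)
  obtain ⟨fLc, gLc⟩ := FG hk₂ (gLc'.add gKc₃)
  obtain ⟨fKd₁, gKd₁⟩ := FG hk₂ (gd₁.mul gd₁)
  obtain ⟨fKd₂, gKd₂⟩ := FG hk₂ (gd₂.mul gd₂)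
  obtain ⟨fKd₃, gKd₃⟩ := FG hk₂ (gd₃.mul gd₃)
  obtain ⟨fLd', gLd'⟩ := FG hk₂ (gKd₁.add gKd₂)
  obtain ⟨fLd, gLd⟩ := FG hk₂ (gLd'.add gKd₃)
  obtain ⟨fTa, gTa⟩ := TG hk₅ (gLa.mul gSbcd)
  obtain ⟨fTb, gTb⟩ := TG hk₅ (gLb.mul gScda)
  obtain ⟨fTc, gTc⟩ := TG hk₅ (gLc.mul gSdab)
  obtain ⟨fTd, gTd⟩ := TG hk₅ (gLd.mul gSabc)
  obtain ⟨fR₁, gR₁⟩ := TG hk₅ (gTd.sub gTc)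
  obtain ⟨fR₂, gR₂⟩ := TG hk₅ (gTb.sub gTa)
  have fD := (FG hk₅ (gR₁.add gR₂)).1
  -- the permanent and the error bound (`2^5e₀ ℤ`, `2^(5e₀ − 2p) ℤ`)
  obtain ⟨fGa, gGa⟩ := TG hk₅' (gWbcd.mul gLa)
  obtain ⟨fGb, gGb⟩ := TG hk₅' (gWcda.mul gLb)
  obtain ⟨fGc, gGc⟩ := TG hk₅' (gWdab.mul gLc)
  obtain ⟨fGd, gGd⟩ := TG hk₅' (gWabc.mul gLd)
  obtain ⟨fU₁, gU₁⟩ := TG hk₅' (gGa.add gGb)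
  obtain ⟨fU₂, gU₂⟩ := TG hk₅' (gU₁.add gGc)
  obtain ⟨fW, gW⟩ := TG hk₅' (gU₂.add gGd)
  have fE := (TG hkK ((onGrid_isperrboundA p).mul gW)).1
  -- THE ERROR ANALYSIS: cofactor terms and `3 × 3` minors
  obtain ⟨eabc₁, babc₁⟩ := cofactor_sub_le_of_rel hu0.le fa₃ fb₁ fc₂ fc₁ fb₂
    fPbc fPbc' fMbc fQabc₁
  obtain ⟨eabc₂, babc₂⟩ := cofactor_sub_le_of_rel hu0.le fb₃ fa₁ fc₂ fc₁ fa₂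
    fPac fPac' fMac fQabc₂
  obtain ⟨eabc₃, babc₃⟩ := cofactor_sub_le_of_rel hu0.le fc₃ fa₁ fb₂ fb₁ fa₂
    fPab fPab' fMab fQabc₃
  obtain ⟨eSabc, bSabc, cSabc⟩ := sum3_sub_le_of_rel hu0.le hb2 (by positivity) eabc₁ eabc₂ eabc₃
    babc₁ babc₂ babc₃ fRabc fSabc
  obtain ⟨ebcd₁, bbcd₁⟩ := cofactor_sub_le_of_rel hu0.le fb₃ fc₁ fd₂ fd₁ fc₂
    fPcd fPcd' fMcd fQbcd₁
  obtain ⟨ebcd₂, bbcd₂⟩ := cofactor_sub_le_of_rel hu0.le fc₃ fb₁ fd₂ fd₁ fb₂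
    fPbd fPbd' fMbd fQbcd₂
  obtain ⟨ebcd₃, bbcd₃⟩ := cofactor_sub_le_of_rel hu0.le fd₃ fb₁ fc₂ fc₁ fb₂
    fPbc fPbc' fMbc fQbcd₃
  obtain ⟨eSbcd, bSbcd, cSbcd⟩ := sum3_sub_le_of_rel hu0.le hb2 (by positivity) ebcd₁ ebcd₂ ebcd₃
    bbcd₁ bbcd₂ bbcd₃ fRbcd fSbcd
  obtain ⟨ecda₁, bcda₁⟩ := cofactor_sub_le_of_rel hu0.le fc₃ fd₁ fa₂ fa₁ fd₂
    fPda fPda' fMda fQcda₁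
  obtain ⟨ecda₂, bcda₂⟩ := cofactor_sub_le_of_rel hu0.le fd₃ fa₁ fc₂ fc₁ fa₂
    fPac fPac' fMac fQcda₂
  obtain ⟨ecda₃, bcda₃⟩ := cofactor_sub_le_of_rel hu0.le fa₃ fc₁ fd₂ fd₁ fc₂
    fPcd fPcd' fMcd fQcda₃
  obtain ⟨eScda, bScda, cScda⟩ := sum3add_sub_le_of_rel hu0.le hb2 (by positivity) ecda₁ ecda₂ ecda₃
    bcda₁ bcda₂ bcda₃ fRcda fScda
  obtain ⟨edab₁, bdab₁⟩ := cofactor_sub_le_of_rel hu0.le fd₃ fa₁ fb₂ fb₁ fa₂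
    fPab fPab' fMab fQdab₁
  obtain ⟨edab₂, bdab₂⟩ := cofactor_sub_le_of_rel hu0.le fa₃ fb₁ fd₂ fd₁ fb₂
    fPbd fPbd' fMbd fQdab₂
  obtain ⟨edab₃, bdab₃⟩ := cofactor_sub_le_of_rel hu0.le fb₃ fd₁ fa₂ fa₁ fd₂
    fPda fPda' fMda fQdab₃
  obtain ⟨eSdab, bSdab, cSdab⟩ := sum3add_sub_le_of_rel hu0.le hb2 (by positivity) edab₁ edab₂ edab₃
    bdab₁ bdab₂ bdab₃ fRdab fSdab
  -- lifts, lifted terms, the determinant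
  obtain ⟨eLa, nLa⟩ := lift3_sub_le_of_rel hu0.le hu1 fa₁ fa₂ fa₃ fKa₁ fKa₂ fKa₃ fLa' fLa
  obtain ⟨eLb, nLb⟩ := lift3_sub_le_of_rel hu0.le hu1 fb₁ fb₂ fb₃ fKb₁ fKb₂ fKb₃ fLb' fLb
  obtain ⟨eLc, nLc⟩ := lift3_sub_le_of_rel hu0.le hu1 fc₁ fc₂ fc₃ fKc₁ fKc₂ fKc₃ fLc' fLc
  obtain ⟨eLd, nLd⟩ := lift3_sub_le_of_rel hu0.le hu1 fd₁ fd₂ fd₃ fKd₁ fKd₂ fKd₃ fLd' fLd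
  obtain ⟨eTa, bTa⟩ := liftedTerm_sub_le_of_rel hu0.le hv nLa eLa eSbcd bSbcd cSbcd fTa
  obtain ⟨eTb, bTb⟩ := liftedTerm_sub_le_of_rel hu0.le hv nLb eLb eScda bScda cScda fTb
  obtain ⟨eTc, bTc⟩ := liftedTerm_sub_le_of_rel hu0.le hv nLc eLc eSdab bSdab cSdab fTc
  obtain ⟨eTd, bTd⟩ := liftedTerm_sub_le_of_rel hu0.le hv nLd eLd eSabc bSabc cSabc fTd
  have herr := det4_sub_le_of_rel hu0.le eTa eTb eTc eTd bTa bTb bTc bTd fR₁ fR₂ fD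
  -- the permanent from below
  have loabc := perm3_lower hu0.le hu1.le (abs_nonneg _) (abs_nonneg _) (abs_nonneg _)
    (by positivity) (by positivity) (by positivity) fAbc fAac fAab fBabc₁ fBabc₂ fBabc₃
    fVabc fWabc
  have lobcd := perm3_lower hu0.le hu1.le (abs_nonneg _) (abs_nonneg _) (abs_nonneg _)
    (by positivity) (by positivity) (by positivity) fAcd fAbd fAbc fBbcd₁ fBbcd₂ fBbcd₃
    fVbcd fWbcd
  have locda := perm3_lower hu0.le hu1.le (abs_nonneg _) (abs_nonneg _) (abs_nonneg _)
    (by positivity) (by positivity) (by positivity) fAda fAac fAcd fBcda₁ fBcda₂ fBcda₃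
    fVcda fWcda
  have lodab := perm3_lower hu0.le hu1.le (abs_nonneg _) (abs_nonneg _) (abs_nonneg _)
    (by positivity) (by positivity) (by positivity) fAab fAbd fAda fBdab₁ fBdab₂ fBdab₃
    fVdab fWdab
  have hE := perm4_lower hu0.le hu1.le (isperrboundA_nonneg p) (by positivity) (by positivity)
    (by positivity) (by positivity) nLa nLb nLc nLd lobcd locda lodab loabc fGa fGb fGc fGd
    fU₁ fU₂ fW fE
  -- the branches of the filter, and the conclusion
  unfold insphereStageA at hA
  simp only [] at hA
  split_ifs at hA with htest
  obtain rfl := Option.some.inj hA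
  obtain ⟨h₁, h₂⟩ := sign_of_err_of_test hu1
    (add_nonneg (add_nonneg (add_nonneg (mul_nonneg nLa (by positivity))
      (mul_nonneg nLb (by positivity))) (mul_nonneg nLc (by positivity)))
      (mul_nonneg nLd (by positivity)))
    herr (Eq.trans_le (by ring) (isperrboundA_margin hu0.le hu64)) hE
    (htest.elim (fun h => lt_of_lt_of_le h (le_abs_self _))
      (fun h => lt_of_lt_of_le h (neg_le_abs _)))
  refine ⟨h₁.trans (iff_of_eq ?_), h₂.trans (iff_of_eq ?_)⟩
  · congr 1
    unfold insphereDet xyzDet3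
    ring
  · congr 1
    unfold insphereDet xyzDet3
    ring

/-! ## The complete predicate: filter, else exact -/

/-- Two rationals whose signs agree strictly both ways vanish together. -/
private theorem eq_zero_iff_of_iffs {r d : ℚ} (h₁ : 0 < r ↔ 0 < d) (h₂ : r < 0 ↔ d < 0) :
    r = 0 ↔ d = 0 := by
  constructor
  · intro hr
    rcases lt_trichotomy d 0 with hd | hd | hd
    · exact absurd (h₂.mpr hd) (by rw [hr]; exact lt_irrefl 0)
    · exact hd
    · exact absurd (h₁.mpr hd) (by rw [hr]; exact lt_irrefl 0)
  · intro hd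
    rcases lt_trichotomy r 0 with hr | hr | hr
    · exact absurd (h₂.mp hr) (by rw [hd]; exact lt_irrefl 0)
    · exact hr
    · exact absurd (h₁.mp hr) (by rw [hd]; exact lt_irrefl 0)

/-- INSPHERE, filtered then exact: the stage-A filter with error-bound constant `K`; if it does
not accept, the last component of the exact expansion of `InsphereExact.lean`. -/
def insphereFiltered (tp : ℚ → ℚ → ℚ × ℚ) (fl : ℚ → ℚ) (K : ℚ)
    (a₁ a₂ a₃ b₁ b₂ b₃ c₁ c₂ c₃ d₁ d₂ d₃ e₁ e₂ e₃ : ℚ) : ℚ :=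
  match insphereStageA fl K a₁ a₂ a₃ b₁ b₂ b₃ c₁ c₂ c₃ d₁ d₂ d₃ e₁ e₂ e₃ with
  | some A => A
  | none => lastComponent (insphereExact tp fl a₁ a₂ a₃ b₁ b₂ b₃ c₁ c₂ c₃ d₁ d₂ d₃ e₁ e₂ e₃)

/-- **INSPHERE, FILTERED THEN EXACT, IS CORRECT**: with `K = isperrboundA p`, `p ≥ 6`, any
round-to-nearest `fl` with `RoundoffBelow 2`, an error-free two-product on `F(p, ke₀) × F(p, e₀)`,
`k = 1, …, 4`, and coordinates in `F(p, e₀)` with `emin ≤ e₀`, `emin + 2p ≤ 5e₀`, the returned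
float has exactly the sign of `insphereDet`. -/
theorem insphereFiltered_correct (hp : 6 ≤ p) (hfl : IsRoundNearest p emin fl)
    (hfl2 : RoundoffBelow 2 fl) {e₀ : ℤ} (hk₀ : emin ≤ e₀)
    (h5 : emin + 2 * p ≤ e₀ + e₀ + e₀ + e₀ + e₀) {tp : ℚ → ℚ → ℚ × ℚ}
    (htp : ∀ x y, IsFloat p e₀ x → IsFloat p e₀ y → ExactTwoProd p emin fl tp x y)
    (htp₂ : ∀ x y, IsFloat p (e₀ + e₀) x → IsFloat p e₀ y → ExactTwoProd p emin fl tp x y)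
    (htp₃ : ∀ x y, IsFloat p (e₀ + e₀ + e₀) x → IsFloat p e₀ y → ExactTwoProd p emin fl tp x y)
    (htp₄ : ∀ x y, IsFloat p (e₀ + e₀ + e₀ + e₀) x → IsFloat p e₀ y →
      ExactTwoProd p emin fl tp x y) {a₁ a₂ a₃ b₁ b₂ b₃ c₁ c₂ c₃ d₁ d₂ d₃ e₁ e₂ e₃ : ℚ}
    (ha₁ : IsFloat p e₀ a₁) (ha₂ : IsFloat p e₀ a₂) (ha₃ : IsFloat p e₀ a₃)
    (hb₁ : IsFloat p e₀ b₁) (hb₂ : IsFloat p e₀ b₂) (hb₃ : IsFloat p e₀ b₃)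
    (hc₁ : IsFloat p e₀ c₁) (hc₂ : IsFloat p e₀ c₂) (hc₃ : IsFloat p e₀ c₃)
    (hd₁ : IsFloat p e₀ d₁) (hd₂ : IsFloat p e₀ d₂) (hd₃ : IsFloat p e₀ d₃)
    (he₁ : IsFloat p e₀ e₁) (he₂ : IsFloat p e₀ e₂) (he₃ : IsFloat p e₀ e₃) :
    (0 < insphereFiltered tp fl (isperrboundA p) a₁ a₂ a₃ b₁ b₂ b₃ c₁ c₂ c₃ d₁ d₂ d₃ e₁ e₂ e₃ ↔
        0 < insphereDet a₁ a₂ a₃ b₁ b₂ b₃ c₁ c₂ c₃ d₁ d₂ d₃ e₁ e₂ e₃) ∧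
      (insphereFiltered tp fl (isperrboundA p) a₁ a₂ a₃ b₁ b₂ b₃ c₁ c₂ c₃ d₁ d₂ d₃ e₁ e₂ e₃ < 0 ↔
        insphereDet a₁ a₂ a₃ b₁ b₂ b₃ c₁ c₂ c₃ d₁ d₂ d₃ e₁ e₂ e₃ < 0) ∧
      (insphereFiltered tp fl (isperrboundA p) a₁ a₂ a₃ b₁ b₂ b₃ c₁ c₂ c₃ d₁ d₂ d₃ e₁ e₂ e₃ = 0 ↔
        insphereDet a₁ a₂ a₃ b₁ b₂ b₃ c₁ c₂ c₃ d₁ d₂ d₃ e₁ e₂ e₃ = 0) := by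
  have key :
      (0 < insphereFiltered tp fl (isperrboundA p) a₁ a₂ a₃ b₁ b₂ b₃ c₁ c₂ c₃ d₁ d₂ d₃ e₁ e₂ e₃ ↔
        0 < insphereDet a₁ a₂ a₃ b₁ b₂ b₃ c₁ c₂ c₃ d₁ d₂ d₃ e₁ e₂ e₃) ∧
      (insphereFiltered tp fl (isperrboundA p) a₁ a₂ a₃ b₁ b₂ b₃ c₁ c₂ c₃ d₁ d₂ d₃ e₁ e₂ e₃ < 0 ↔
        insphereDet a₁ a₂ a₃ b₁ b₂ b₃ c₁ c₂ c₃ d₁ d₂ d₃ e₁ e₂ e₃ < 0) := by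
    unfold insphereFiltered
    cases hA : insphereStageA fl (isperrboundA p) a₁ a₂ a₃ b₁ b₂ b₃ c₁ c₂ c₃ d₁ d₂ d₃ e₁ e₂ e₃
      with
    | some A =>
      exact insphereStageA_correct hp hfl hk₀ h5 ha₁ ha₂ ha₃ hb₁ hb₂ hb₃ hc₁ hc₂ hc₃ hd₁ hd₂ hd₃
        he₁ he₂ he₃ hA
    | none =>
      obtain ⟨hD, s₁, s₂, -⟩ := insphereExact_sign (le_trans (by norm_num) hp) hfl hfl2
        (show emin ≤ e₀ + e₀ by omega) (show emin ≤ e₀ + e₀ + e₀ by omega)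
        (show emin ≤ e₀ + e₀ + e₀ + e₀ by omega) (show emin ≤ e₀ + e₀ + e₀ + e₀ + e₀ by omega)
        htp htp₂ htp₃ htp₄ ha₁ ha₂ ha₃ hb₁ hb₂ hb₃ hc₁ hc₂ hc₃ hd₁ hd₂ hd₃ he₁ he₂ he₃
      simp only [lastComponent_eq_getLast hD]
      exact ⟨s₁.symm, s₂.symm⟩
  exact ⟨key.1, key.2, eq_zero_iff_of_iffs key.1 key.2⟩

/-- The IEEE instance: round-to-nearest-even and the FMA two-product. -/
def insphereFilteredRNE (p : ℕ) (emin : ℤ)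
    (a₁ a₂ a₃ b₁ b₂ b₃ c₁ c₂ c₃ d₁ d₂ d₃ e₁ e₂ e₃ : ℚ) : ℚ :=
  insphereFiltered (twoProdFMA (roundTiesEven p emin)) (roundTiesEven p emin) (isperrboundA p)
    a₁ a₂ a₃ b₁ b₂ b₃ c₁ c₂ c₃ d₁ d₂ d₃ e₁ e₂ e₃

/-- **INSPHERE, FILTERED THEN EXACT, IS CORRECT ON AN IEEE MACHINE** (`p ≥ 6`, ties-to-even,
FMA): for coordinates in `F(p, e₀)` with `emin ≤ e₀` and `emin + 2p ≤ 5e₀` (binary64: all fifteen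
coordinates multiples of `2^−193`) the returned float has exactly the sign of `insphereDet`. -/
theorem insphereFilteredRNE_correct (hp : 6 ≤ p) {e₀ : ℤ} (hk₀ : emin ≤ e₀)
    (h5 : emin + 2 * p ≤ e₀ + e₀ + e₀ + e₀ + e₀)
    {a₁ a₂ a₃ b₁ b₂ b₃ c₁ c₂ c₃ d₁ d₂ d₃ e₁ e₂ e₃ : ℚ}
    (ha₁ : IsFloat p e₀ a₁) (ha₂ : IsFloat p e₀ a₂) (ha₃ : IsFloat p e₀ a₃)
    (hb₁ : IsFloat p e₀ b₁) (hb₂ : IsFloat p e₀ b₂) (hb₃ : IsFloat p e₀ b₃)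
    (hc₁ : IsFloat p e₀ c₁) (hc₂ : IsFloat p e₀ c₂) (hc₃ : IsFloat p e₀ c₃)
    (hd₁ : IsFloat p e₀ d₁) (hd₂ : IsFloat p e₀ d₂) (hd₃ : IsFloat p e₀ d₃)
    (he₁ : IsFloat p e₀ e₁) (he₂ : IsFloat p e₀ e₂) (he₃ : IsFloat p e₀ e₃) :
    (0 < insphereFilteredRNE p emin a₁ a₂ a₃ b₁ b₂ b₃ c₁ c₂ c₃ d₁ d₂ d₃ e₁ e₂ e₃ ↔
        0 < insphereDet a₁ a₂ a₃ b₁ b₂ b₃ c₁ c₂ c₃ d₁ d₂ d₃ e₁ e₂ e₃) ∧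
      (insphereFilteredRNE p emin a₁ a₂ a₃ b₁ b₂ b₃ c₁ c₂ c₃ d₁ d₂ d₃ e₁ e₂ e₃ < 0 ↔
        insphereDet a₁ a₂ a₃ b₁ b₂ b₃ c₁ c₂ c₃ d₁ d₂ d₃ e₁ e₂ e₃ < 0) ∧
      (insphereFilteredRNE p emin a₁ a₂ a₃ b₁ b₂ b₃ c₁ c₂ c₃ d₁ d₂ d₃ e₁ e₂ e₃ = 0 ↔
        insphereDet a₁ a₂ a₃ b₁ b₂ b₃ c₁ c₂ c₃ d₁ d₂ d₃ e₁ e₂ e₃ = 0) := by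
  have hp1 : 1 ≤ p := le_trans (by norm_num) hp
  have hfl : IsRoundNearest p emin (roundTiesEven p emin) := isRoundNearest_roundTiesEven hp1
  have T : ∀ {g : ℤ}, emin ≤ g + e₀ → ∀ x y, IsFloat p g x → IsFloat p e₀ y →
      ExactTwoProd p emin (roundTiesEven p emin) (twoProdFMA (roundTiesEven p emin)) x y :=
    fun h x y hx hy => exactTwoProd_twoProdFMA₂ hp1 hfl h hx hy
  exact insphereFiltered_correct hp hfl (roundoffBelow_two_roundTiesEven p emin) hk₀ h5
    (T (by omega)) (T (by omega)) (T (by omega)) (T (by omega))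
    ha₁ ha₂ ha₃ hb₁ hb₂ hb₃ hc₁ hc₂ hc₃ hd₁ hd₂ hd₃ he₁ he₂ he₃

end Summit.Ventures.CertifiedArithmetic.Expansions
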